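/-
Copyright (c) 2026 the pub-hodgecm-mathlib formalisation cell (harness21).  Prover seat hodgecm-mathlib-LH4-p13 (g6): Track A «(D-RAM) FOUR-FRAME» squad of crux H413,
unit U2H (ii-H), census leaf (ρ2b′-X) — socket (B) (type RamK bottom; lead LH4-p07 (g7)), organ (B-top∕ε) PART IIIa: THE NORMALISER AND THE TOKEN-SIDE FACTS AT THE CM LETTERS, 2026-09-04.
-/
import Summits.HodgeConjecture.HodgeConjecture.Theorems.F0P3cDyRamOrderCountCensusRamKTop   -- ★ p858080 (this seat) F2: `btop_tokens_ramK`, `btop_side_ramK`; brings F1 ★ p858055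
import Summits.HodgeConjecture.HodgeConjecture.Theorems.F0P3cDyRamTokenSignDepthSymbol     -- ★ p857924 (this seat): `valued_eq_one_of_map_mul_self`; brings ★ p857454 `exists_normOne_sqrt`
import HarnessLib

/-!
# F0 · P3c · line LH4 «(D-RAM) FOUR-FRAME» — socket (B), organ (B-top∕ε), part IIIa: the normaliser and the token-side facts at the CM letters
(Rogawski 1990 §4.9; Labesse–Langlands 1979 §2; Serre 1979 Ch. V §§2–3)

Cell `pub/hodgecm-mathlib`, crux H413 = `stmt-HodgeConjecture-24833` (helper lane, count-neutral); THEOREMS ONLY (no definition, no instance, no notation, no named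
fact, no `sorry`).  LETTERS: the CM place `w ∣ v` of `L ∕ L⁺` (`σ_w`, `ι_w = toPlace v w`, `θ = cmQuadraticGenerator L`), its ramified datum `IsRamifiedQuadraticDatum σ_w ϖ d tE`
and dyadic letter `|2|_w < 1`; an ABSTRACT complete third field `M` with `jE : L_w →+* M` isometric, commuting isometric involutions `ρ`, `Θ` with `Fix ρ = jE(L_w)`,
`Θ ∘ jE = jE ∘ σ_w` and the transported datum `IsRamifiedQuadraticDatum Θ (jE ϖ) d tE` (socket (B) = `SOCKET-hOCB.v1` with `M := E′_{w₁}`, `jE := toPlace w.1 w₁`); the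
type-(B) letters `|α| ≤ 1`, `|α − ρα| = 1`, `|α − Θα| < 1`; the eigen-letters of the socket (`Θλ·λ = 1`, `λ² = tr·λ − D`, `ρλ = tr − λ`, `x² − tr·x + D` rootless in `L_w`,
`D·σD = 1`); the `U(1)` scalar `u₀ ∈ L_w¹`; the token `|λ − jE u₀| = exp(−m)` (and `|μ − ρμ| = exp(−jλ)` for the parities) with ONE depth letter `2d + 3tE ≤ m` (the head's `V`);
and the symmetrised discriminant `β ∈ L⁺_v` with `ι β = −χ(u₀² + D)∕(2u₀²D)`, `χ = u₀² − tr·u₀ + D`.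

WHAT IS PROVED — towards F0P3-p01 (g33)'s ★ p858068 `toricCensusSum_ramK_weld` residual hypotheses AT THESE LETTERS:
* §1 `exists_normOne_sqrt_det`: the NORMALISER `ν₀ ∈ L_w¹` (`ν₀² = D`, `|u₀ − ν₀| ≤ exp(−(m − tE))`, `|u₀ − ν₀| < |2|`) from ★ p857454 §4 at `D∕u₀²`.
* §2 `exists_normaliser_letters`: the M-side letters `u := jE u₀`, `ν := jE ν₀` (`ρ`-fixed, `Θ`-unitary, `λρλ = ν²`, `|u − ν| < |2|`, `|λ − ν| = exp(−mλ)` with `m − tE ≤ mλ`,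
  `|u₀∕ν₀ − 1| ≤ |ϖ|^{m−tE}`), and **`btop_tokens_cm … : 2 ≤ d ∧ 3d ≤ jλ + 2 + 2(d % 2) ∧ m % 2 = d % 2 ∧ d − d % 2 ≤ m + 1`** (= the weld's `hd2 hjlS hmpar hmS`;
  F2 §2 at `ν := jE ν₀`).  Part IIIb (`…OrderCountCensusRamKSymbol`) does the side letter `hside` with `ε := (β, θ)_v`.

HONEST LABEL: HC_CM is proved only modulo the 7 printed citations (2 remaining named inputs: hLiu418 = stmt-HodgeConjecture-24832, h413 = stmt-HodgeConjecture-24833) until rung 0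
closes; (ρ2b′-X) :418 is an OPEN prover target — this file is a helper (`--supports`), proofs only; socket (B) is OPEN (lead LH4-p07 (g7) composes).

## References
* [Rogawski1990] J. D. Rogawski, *Automorphic Representations of Unitary Groups in Three Variables*, Ann. of Math. Stud. 123 (1990), §4.9 Prop. 4.9.1 (b) p. 55, Lemma 4.9.3 p. 56.
* [LabesseLanglands1979] J.-P. Labesse, R. P. Langlands, *L-indistinguishability for SL(2)*, Canad. J. Math. 31 (1979), §2 (2.1)–(2.2).
* [Serre1979] J.-P. Serre, *Local Fields*, GTM 67 (1979), Ch. V §2 Prop. 3, §3 Cor. 3; Ch. XIV §§3–4.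
-/

set_option autoImplicit false

noncomputable section

open NumberField IsDedekindDomain WithZero IsLocalRing
open Literature.NumberTheory.Automorphic Literature.NumberTheory.Automorphic.UnitaryGroup Literature.NumberTheory.GaloisRepresentations
open Literature.NumberTheory.QuadraticForms Literature.NumberTheory.Rogawski1990
open Literature.NumberTheory.Automorphic.UnitaryThreeFourFrame
open scoped Valued

namespace Summit.HodgeConjecture.HodgeConjecture.Cruxes.H413.F0P3cDyRamOrderCountCensusRamKNormaliser

open Literature.NumberTheory.LocalFields.WildQuadraticDatum (v_varpi_pow)
open Summit.HodgeConjecture.HodgeConjecture.Cruxes.H413.F0P3cDyRamTokenSignUnr (exists_normOne_sqrt)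
open Summit.HodgeConjecture.HodgeConjecture.Cruxes.H413.F0P3cDyRamTokenSignDepthSymbol (valued_eq_one_of_map_mul_self)
open Summit.HodgeConjecture.HodgeConjecture.Cruxes.H413.F0P3cDyRamOrderCountCensusRamKTop (btop_tokens_ramK)

variable (L : Type) [Field L] [NumberField L] [IsCMField L] {v : HeightOneSpectrum (𝓞 ↥(maximalRealSubfield L))}
  (w : PlacesOver L v) (hw : IsCMField.complexConj L • w.1 = w.1)

/-! ## §1 The normaliser: a norm-one square root of `D` next to `u₀` -/

include hw in
/-- **THE NORMALISER `ν₀`.**  For `u₀, D ∈ L_w¹` with `|D − u₀²| ≤ exp(−m)`, `|2| = exp(−tE)`, `2tE + 1 ≤ m`: some `ν₀` with `ν₀² = D`, `σν₀·ν₀ = 1`, `|u₀ − ν₀| < |2|` and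
`|u₀ − ν₀| ≤ exp(−(m − tE))` — `ν₀ := u₀·r`, `r` the norm-one square root of `D∕u₀²` near `1` (★ p857454 §4), sharpened by `|r − 1|·|2| = |r² − 1|`. [cite: Serre1979, Ch. XIV §4] -/
theorem exists_normOne_sqrt_det (hσv : ∀ x, Valued.v (galAdicCompletionMap (L := L) (IsCMField.complexConj L) hw x) = Valued.v x)
    {u₀ D : w.1.adicCompletion L} (hσu₀ : galAdicCompletionMap (L := L) (IsCMField.complexConj L) hw u₀ * u₀ = 1)
    (hDσ : D * galAdicCompletionMap (L := L) (IsCMField.complexConj L) hw D = 1)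
    {m tE : ℕ} (h2t : Valued.v (2 : w.1.adicCompletion L) = exp (-(tE : ℤ))) (hmt : 2 * tE + 1 ≤ m)
    (hDu : Valued.v (D - u₀ ^ 2) ≤ exp (-(m : ℤ))) :
    ∃ ν₀ : w.1.adicCompletion L, ν₀ * ν₀ = D ∧ galAdicCompletionMap (L := L) (IsCMField.complexConj L) hw ν₀ * ν₀ = 1 ∧
      Valued.v (u₀ - ν₀) < Valued.v (2 : w.1.adicCompletion L) ∧ Valued.v (u₀ - ν₀) ≤ exp (-((m : ℤ) - tE)) := by
  set σ := galAdicCompletionMap (L := L) (IsCMField.complexConj L) hw with hσdef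
  have hvu : Valued.v u₀ = 1 := valued_eq_one_of_map_mul_self L w hσv hσu₀
  have hu0 : u₀ ≠ 0 := fun h0 => by rw [h0, map_zero] at hvu; exact zero_ne_one hvu
  have h20 : (2 : w.1.adicCompletion L) ≠ 0 := fun h0 => by rw [h0, map_zero] at h2t; exact (exp_ne_zero h2t.symm).elim
  -- `u' := D∕u₀²` is norm-one and `exp(−m)`-close to `1`
  set u' : w.1.adicCompletion L := D / u₀ ^ 2 with hu'
  have hσu' : σ u' * u' = 1 := by
    have hσu : σ u₀ = u₀⁻¹ := eq_inv_of_mul_eq_one_left hσu₀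
    have hσD : σ D = D⁻¹ := eq_inv_of_mul_eq_one_right hDσ
    have hD0 : D ≠ 0 := fun h0 => by rw [h0, zero_mul] at hDσ; exact zero_ne_one hDσ
    rw [hu', map_div₀, map_pow, hσu, hσD]; field_simp
  have hu'1 : Valued.v (u' - 1) ≤ exp (-(m : ℤ)) := by
    rw [hu', show D / u₀ ^ 2 - 1 = (D - u₀ ^ 2) / u₀ ^ 2 by field_simp, map_div₀, map_pow, hvu, one_pow, div_one]
    exact hDu
  have h4 : Valued.v (u' - 1) < Valued.v (4 : w.1.adicCompletion L) := by
    rw [show (4 : w.1.adicCompletion L) = 2 * 2 by norm_num, Valuation.map_mul, h2t, ← exp_add]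
    refine hu'1.trans_lt ?_
    rw [exp_lt_exp]; omega
  obtain ⟨r, hrr, hσr, hr1⟩ := exists_normOne_sqrt L w hw hσv hσu' h4
  -- the sharpening `|r − 1|·|2| = |u' − 1|`
  have hr2 : Valued.v (r + 1) = Valued.v (2 : w.1.adicCompletion L) := by
    rw [show r + 1 = 2 + (r - 1) by ring, Valuation.map_add_eq_of_lt_left _ hr1]
  have hkey : Valued.v (r - 1) * exp (-(tE : ℤ)) = Valued.v (u' - 1) := by
    rw [← h2t, ← hr2, ← Valuation.map_mul, ← hrr]; ring_nf
  have hr1' : Valued.v (r - 1) ≤ exp (-((m : ℤ) - tE)) := by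
    have h := hu'1
    rw [← hkey] at h
    have h' : Valued.v (r - 1) * exp (-(tE : ℤ)) * exp (tE : ℤ) ≤ exp (-(m : ℤ)) * exp (tE : ℤ) := by gcongr
    rw [mul_assoc, ← exp_add, ← exp_add, neg_add_cancel, exp_zero, mul_one] at h'
    refine h'.trans_eq ?_
    congr 1; ring
  refine ⟨u₀ * r, ?_, ?_, ?_, ?_⟩
  · rw [show u₀ * r * (u₀ * r) = u₀ ^ 2 * (r * r) by ring, hrr, hu']; field_simp
  · rw [map_mul, show σ u₀ * σ r * (u₀ * r) = (σ u₀ * u₀) * (σ r * r) by ring, hσu₀, hσr, mul_one]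
  · rw [show u₀ - u₀ * r = -(u₀ * (r - 1)) by ring, Valuation.map_neg, Valuation.map_mul, hvu, one_mul]; exact hr1
  · rw [show u₀ - u₀ * r = -(u₀ * (r - 1)) by ring, Valuation.map_neg, Valuation.map_mul, hvu, one_mul]; exact hr1'

/-! ## §2 The M-side letters of the normaliser and the token-side facts -/

include hw in
/-- **M-SIDE LETTERS OF THE FRAME AND THE NORMALISER.**  From the socket clauses: `u := jE u₀` is `ρ`-fixed and `Θ`-unitary, `λ·ρλ = jE D`, `|2|_M = exp(−tE) < 1`,
`|D − u₀²| ≤ exp(−m)`, and for the normaliser `ν₀` of §1: `ν := jE ν₀` is `ρ`-fixed, `Θ`-unitary, `λρλ = ν²`, `|u − ν| < |2|`, and `|λ − ν| = exp(−mλ)` with `m − tE ≤ mλ`.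
[cite: Rogawski1990, §4.9 p. 55] [cite: Serre1979, Ch. XIV §4] -/
theorem exists_normaliser_letters
    (ϖ : w.1.adicCompletion L) (d tE : ℕ) (hD : IsRamifiedQuadraticDatum (galAdicCompletionMap (L := L) (IsCMField.complexConj L) hw) ϖ d tE)
    (h2v : Valued.v (2 : w.1.adicCompletion L) < 1)
    {M : Type} [Field M] [Valued M ℤᵐ⁰] (jE : w.1.adicCompletion L →+* M) (hjv : ∀ a, Valued.v (jE a) = Valued.v a)
    (ρ Θ : M →+* M) (hvρ : ∀ z, Valued.v (ρ z) = Valued.v z)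
    (hjfix : ∀ z, ρ z = z ↔ ∃ a, jE a = z) (hΘj : ∀ a, Θ (jE a) = jE (galAdicCompletionMap (L := L) (IsCMField.complexConj L) hw a))
    {lam : M} {tr D : w.1.adicCompletion L} (hlam2 : lam * lam = jE tr * lam - jE D) (hρlam : ρ lam = jE tr - lam)
    (hirr : ∀ x : w.1.adicCompletion L, x * x - tr * x + D ≠ 0) (hDσ : D * galAdicCompletionMap (L := L) (IsCMField.complexConj L) hw D = 1)
    {u₀ : w.1.adicCompletion L} (hσu₀ : galAdicCompletionMap (L := L) (IsCMField.complexConj L) hw u₀ * u₀ = 1)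
    {m : ℕ} (hm : Valued.v (lam - jE u₀) = exp (-(m : ℤ))) (hmt : 2 * tE + 1 ≤ m) :
    ∃ ν₀ : w.1.adicCompletion L, ∃ mlam : ℕ, ν₀ * ν₀ = D ∧ galAdicCompletionMap (L := L) (IsCMField.complexConj L) hw ν₀ * ν₀ = 1 ∧
      Valued.v (u₀ / ν₀ - 1) ≤ Valued.v ϖ ^ (m - tE) ∧
      ρ (jE u₀) = jE u₀ ∧ jE u₀ * Θ (jE u₀) = 1 ∧ ρ (jE ν₀) = jE ν₀ ∧ jE ν₀ * Θ (jE ν₀) = 1 ∧ lam * ρ lam = jE ν₀ ^ 2 ∧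
      Valued.v (jE u₀ - jE ν₀) < Valued.v (2 : M) ∧ Valued.v (lam - jE ν₀) = exp (-(mlam : ℤ)) ∧ m ≤ mlam + tE ∧
      Valued.v (2 : M) < 1 := by
  have hD' := hD
  obtain ⟨hσσ, hσv, hϖ, -, -, -, h2t⟩ := hD'
  set σ := galAdicCompletionMap (L := L) (IsCMField.complexConj L) hw with hσdef
  have hπ : ∀ n : ℕ, Valued.v ϖ ^ n = exp (-(n : ℤ)) := v_varpi_pow hϖ
  rw [hπ] at h2t
  have hj2 : jE 2 = 2 := map_ofNat jE 2
  have h2M : Valued.v (2 : M) = exp (-(tE : ℤ)) := by rw [← hj2, hjv, h2t]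
  have hvu : Valued.v u₀ = 1 := valued_eq_one_of_map_mul_self L w hσv hσu₀
  have hu0 : u₀ ≠ 0 := fun h0 => by rw [h0, map_zero] at hvu; exact zero_ne_one hvu
  -- `u := jE u₀`
  have hρu : ρ (jE u₀) = jE u₀ := (hjfix _).2 ⟨u₀, rfl⟩
  have hu1 : jE u₀ * Θ (jE u₀) = 1 := by rw [hΘj, ← map_mul, mul_comm, hσu₀, map_one]
  -- `λρλ = jE D` and `|D − u₀²| ≤ exp(−m)`
  have hdet : lam * ρ lam = jE D := by rw [hρlam]; linear_combination -hlam2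
  have hlamv : Valued.v lam = 1 := by
    -- `|λ − jE u₀| < 1` and `|jE u₀| = 1`
    have hlt : Valued.v (lam - jE u₀) < Valued.v (jE u₀) := by
      rw [hm, hjv, hvu, ← exp_zero, exp_lt_exp]; omega
    have h := Valuation.map_add_eq_of_lt_left _ hlt
    rwa [add_sub_cancel, hjv, hvu] at h
  have hDu : Valued.v (D - u₀ ^ 2) ≤ exp (-(m : ℤ)) := by
    rw [← hjv, map_sub, map_pow, ← hdet,
      show lam * ρ lam - jE u₀ ^ 2 = (lam - jE u₀) * ρ lam + jE u₀ * ρ (lam - jE u₀) by rw [map_sub, hρu]; ring]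
    refine (Valuation.map_add _ _ _).trans (max_le ?_ ?_)
    · rw [Valuation.map_mul, hm, hvρ, hlamv, mul_one]
    · rw [Valuation.map_mul, hjv, hvu, one_mul, hvρ, hm]
  obtain ⟨ν₀, hνν, hσν, hν2, hν1⟩ := exists_normOne_sqrt_det L w hw hσv hσu₀ hDσ h2t hmt hDu
  have hvν : Valued.v ν₀ = 1 := valued_eq_one_of_map_mul_self L w hσv hσν
  have hν0 : ν₀ ≠ 0 := fun h0 => by rw [h0, map_zero] at hvν; exact zero_ne_one hvν
  -- `λ ≠ jE ν₀` (the characteristic polynomial is rootless in `L_w`)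
  have hne : lam - jE ν₀ ≠ 0 := by
    intro h0
    have hl : lam = jE ν₀ := sub_eq_zero.1 h0
    apply hirr ν₀
    apply jE.injective
    rw [map_zero, map_add, map_sub, map_mul, map_mul, ← hl]
    linear_combination hlam2
  have hv0 : Valued.v (lam - jE ν₀) ≠ 0 := (Valuation.ne_zero_iff _).2 hne
  -- `|λ − jE ν₀| ≤ exp(−(m − tE))`
  have hle : Valued.v (lam - jE ν₀) ≤ exp (-((m : ℤ) - tE)) := by
    rw [show lam - jE ν₀ = (lam - jE u₀) + jE (u₀ - ν₀) by rw [map_sub]; ring]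
    refine (Valuation.map_add _ _ _).trans (max_le ?_ ?_)
    · rw [hm, exp_le_exp]; omega
    · rw [hjv]; exact hν1
  obtain ⟨k, hk⟩ : ∃ k : ℤ, Valued.v (lam - jE ν₀) = exp k := ⟨_, (exp_log hv0).symm⟩
  have hk0 : k ≤ -((m : ℤ) - tE) := by rw [hk, exp_le_exp] at hle; exact hle
  refine ⟨ν₀, (-k).toNat, hνν, hσν, ?_, hρu, hu1, (hjfix _).2 ⟨ν₀, rfl⟩, ?_, ?_, ?_, ?_, ?_, ?_⟩
  · -- `|u₀∕ν₀ − 1| ≤ |ϖ|^(m − tE)`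
    rw [show u₀ / ν₀ - 1 = (u₀ - ν₀) / ν₀ by field_simp, map_div₀, hvν, div_one, hπ]
    refine hν1.trans_eq ?_
    congr 1; omega
  · rw [hΘj, ← map_mul, mul_comm, hσν, map_one]
  · rw [hdet, ← map_pow, sq, hνν]
  · rw [← map_sub, hjv, ← hj2, hjv]; exact hν2
  · rw [hk]; congr 1; omega
  · omega
  · rw [h2M, ← exp_zero, exp_lt_exp]
    have : (1 : ℤ) ≤ tE := by
      by_contra h0
      have ht0 : tE = 0 := by omega
      rw [ht0, Nat.cast_zero, neg_zero, exp_zero] at h2t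
      exact absurd h2t (ne_of_lt h2v)
    omega

include hw in
/-- **THE TOKEN-SIDE FACTS `hd2 hjlS hmpar hmS` OF THE WELD AT THE CM LETTERS** (F2 §2 `btop_tokens_ramK` at the normaliser `ν := jE ν₀` of §2).
[cite: Rogawski1990, §4.9 Prop. 4.9.1 (b) p. 55, Lemma 4.9.3 p. 56] [cite: Serre1979, Ch. V §3 Prop. 5] -/
theorem btop_tokens_cm
    (ϖ : w.1.adicCompletion L) (d tE : ℕ) (hD : IsRamifiedQuadraticDatum (galAdicCompletionMap (L := L) (IsCMField.complexConj L) hw) ϖ d tE)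
    (h2v : Valued.v (2 : w.1.adicCompletion L) < 1)
    {M : Type} [Field M] [Valued M ℤᵐ⁰] (jE : w.1.adicCompletion L →+* M) (hjv : ∀ a, Valued.v (jE a) = Valued.v a)
    (ρ Θ : M →+* M) (hρρ : ∀ z, ρ (ρ z) = z) (hvρ : ∀ z, Valued.v (ρ z) = Valued.v z) (hΘρ : ∀ z, Θ (ρ z) = ρ (Θ z))
    (hjfix : ∀ z, ρ z = z ↔ ∃ a, jE a = z) (hΘj : ∀ a, Θ (jE a) = jE (galAdicCompletionMap (L := L) (IsCMField.complexConj L) hw a))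
    (hDΘ : IsRamifiedQuadraticDatum Θ (jE ϖ) d tE)
    {α : M} (hα1 : Valued.v α ≤ 1) (hα : Valued.v (α - ρ α) = 1) (hram : Valued.v (α - Θ α) < 1)
    {lam : M} {tr D : w.1.adicCompletion L} (hΘlam : Θ lam * lam = 1) (hlam2 : lam * lam = jE tr * lam - jE D) (hρlam : ρ lam = jE tr - lam)
    (hirr : ∀ x : w.1.adicCompletion L, x * x - tr * x + D ≠ 0) (hDσ : D * galAdicCompletionMap (L := L) (IsCMField.complexConj L) hw D = 1)
    {u₀ : w.1.adicCompletion L} (hσu₀ : galAdicCompletionMap (L := L) (IsCMField.complexConj L) hw u₀ * u₀ = 1)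
    {m jl : ℕ} (hm : Valued.v (lam - jE u₀) = exp (-(m : ℤ))) (hjl : Valued.v ((lam - jE u₀) - ρ (lam - jE u₀)) = exp (-(jl : ℤ)))
    (hm0 : 2 * d + 3 * tE ≤ m) :
    2 ≤ d ∧ 3 * d ≤ jl + 2 + 2 * (d % 2) ∧ m % 2 = d % 2 ∧ d - d % 2 ≤ m + 1 := by
  have hd1 : 1 ≤ d := hD.2.2.2.2.2.1
  obtain ⟨ν₀, mlam, -, -, -, hρu, hu1, hρν, -, -, hν2, hlam1, hmm, h2M⟩ :=
    exists_normaliser_letters L w hw ϖ d tE hD h2v jE hjv ρ Θ hvρ hjfix hΘj hlam2 hρlam hirr hDσ hσu₀ hm (by omega)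
  have hρϖ : ρ (jE ϖ) = jE ϖ := (hjfix _).2 ⟨ϖ, rfl⟩
  have hlam : lam * Θ lam = 1 := by rw [mul_comm]; exact hΘlam
  exact btop_tokens_ramK hρρ hvρ hΘρ hα1 hα hDΘ hρϖ h2M hram hlam hρu hu1 hρν hm hjl hlam1 (by omega) hν2

end Summit.HodgeConjecture.HodgeConjecture.Cruxes.H413.F0P3cDyRamOrderCountCensusRamKNormaliser

end
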